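import Literature.AlgebraicGeometry.Hu2025.Proofs.S01S09Interface.GammaQuadHu22SetupTorus
import Literature.AlgebraicGeometry.Hu2025.Proofs.S03Pluecker.GammaQuadTorusTorsor
import HarnessLib

/-!
# Hu 2022 p.131–132, reading (β) — the quotient map of the (β)-inhabitant `S_quad_torus` is a GLOBALLY TRIVIAL torus bundle,
# at scheme level in `Spec`-of-Laurent form: `cell ≅ Spec((𝒪(X_quad))[t₁^±,…,t₈^±])` over `X_quad`
# (joint J1 / GAP-LEDGER-HU row HU-R01 — OURS; nothing of the sources asserted)

**HONEST FRAMING (D-0012/D-0089).** [Hu2025] (arXiv:2507.21400v1) / [Hu2022] (arXiv:2203.03842v4) are unrefereed preprints under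
adjudication; nothing of them is asserted. [Hu22] p.132 l.30–51 glosses the quotient map `π : Gr_d → Gr̄_d` (p.131 l.10–16) as
«a principal `(𝔾ⁿ_m/𝔾_m)`-bundle … Zariski locally trivial … (9.4) `Gr_d|_O ≅ O × (𝔾ⁿ_m/𝔾_m)` … `(𝔾ⁿ_m/𝔾_m) ≅ 𝔾^{n−1}_m =
Spec 𝔽[s^±_1, ⋯, s^±_{n−1}]`» (row 110 g/h: `Hu22P132L30`, `quot_trivialises`, res-type-024). For the (β)-inhabitant
`Torus.S_quad_torus` (`GammaQuadHu22SetupTorus`, `X := X_quad = Gr_d/(𝔾⁹_m/𝔾_m)` as the normal-form slice, `quot = quotX`) THIS FILE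
transports the ring-level torsor isomorphism `QuadTorus.torsorEquiv : Rh ≃+* (Rh ⧸ J)[t^±]` (`GammaQuadTorusTorsor`) to schemes:
* `laurentX := Spec ((Rh ℚ ⧸ J)[t₁^±, …, t₈^±])` («`X_quad × 𝔾⁸_m`» in `Spec`-of-Laurent form) with `laurentProj : laurentX ⟶ X_quad`
  (= `Spec ιL`, the projection);
* **`cellIsoLaurent : Lit.cellScheme ≅ laurentX`** and **`cellIsoLaurent_hom_laurentProj : cellIsoLaurent.hom ≫ laurentProj = quotX`**:
  the quotient map `π = quotX : Gr_d → X_quad` IS, up to this isomorphism, the projection `X_quad × 𝔾⁸_m → X_quad` — (9.4) with ONE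
  open set for `d = quad`.
NOT done here (said so): the identification of `Spec (R[t₁^±,…,t₈^±])` with row 110 g's `splitTorusOver 8 (Spec R)` (a basic open of
Mathlib's `𝔸(Fin 8; Spec R)`) and hence the literal field `quot_trivialises` / `Hu22P132L30`; and `X_quad` as an open of `𝔸⁶` (`r ≥ 1`).
OURS kernel statements about the typed carriers; nothing of [Hu25]/[Hu22] asserted. AI proof is weaker than expert review.
-/

noncomputable section

namespace Literature.AlgebraicGeometry.Hu2025.Statements.S01S09Interface

namespace Torus

open _root_.CategoryTheory _root_.AlgebraicGeometry S03Pluecker S07GammaSchemes S08MainTheorem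

/-- **`laurentX := Spec ((Rh ℚ ⧸ J)[t₁^±, …, t₈^±])`** — «`X_quad × 𝔾⁸_m`» (split torus of rank `n − 1 = 8` over the slice), in
`Spec`-of-Laurent form. OURS.
[cite: Hu2025, Thm. 9.4 p.161; [Hu22] p.132 l.43–51 («(9.4) Gr_d|_O ≅ O × (𝔾ⁿ_m/𝔾_m) … 𝔾^{n−1}_m = Spec 𝔽[s^±_1, ⋯, s^±_{n−1}]»); joint J1 = GAP-LEDGER-HU row HU-R01 (unrefereed preprints under adjudication, D-0012/D-0089 — kernel statement about OUR typed records of rows 101/110; nothing of the sources asserted)] -/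
def laurentX : Scheme.{0} := Spec (CommRingCat.of (QuadTorus.LaurentSlice ℚ))

/-- **The projection `X_quad × 𝔾⁸_m → X_quad`** (= `Spec` of the inclusion `ιL` of the slice functions). OURS.
[cite: Hu2025, Thm. 9.4 p.161; [Hu22] p.132 l.43–51; joint J1 = GAP-LEDGER-HU row HU-R01 (unrefereed preprints under adjudication, D-0012/D-0089 — kernel statement about OUR typed records; nothing of the sources asserted)] -/
def laurentProj : laurentX ⟶ X_quad := Spec.map (CommRingCat.ofHom (QuadTorus.ιL ℚ))

/-- The ring map `(Rh ⧸ J)[t^±] → CellRing` (inverse torsor map followed by the identification of cell rings). OURS plumbing.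
[cite: Hu2025, Thm. 9.4 p.161; [Hu22] p.132 l.43–51; joint J1 = GAP-LEDGER-HU row HU-R01 (unrefereed preprints under adjudication, D-0012/D-0089 — kernel statement about OUR typed records; nothing of the sources asserted)] -/
def laurentToCell : QuadTorus.LaurentSlice ℚ →+* Lit.CellRing := cellRingEquiv.symm.toRingHom.comp (QuadTorus.Φ ℚ)

/-- The ring map `CellRing → (Rh ⧸ J)[t^±]` (identification of cell rings followed by the torsor map `Ψ`). OURS plumbing.
[cite: Hu2025, Thm. 9.4 p.161; [Hu22] p.132 l.43–51; joint J1 = GAP-LEDGER-HU row HU-R01 (unrefereed preprints under adjudication, D-0012/D-0089 — kernel statement about OUR typed records; nothing of the sources asserted)] -/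
def cellToLaurent : Lit.CellRing →+* QuadTorus.LaurentSlice ℚ := (QuadTorus.Ψ ℚ).comp cellRingEquiv.toRingHom

/-- `laurentToCell ∘ cellToLaurent = id`.
[cite: Hu2025, Thm. 9.4 p.161; [Hu22] p.132 l.43–51; joint J1 = GAP-LEDGER-HU row HU-R01 (unrefereed preprints under adjudication, D-0012/D-0089 — kernel statement about OUR typed records; nothing of the sources asserted)] -/
theorem laurentToCell_comp_cellToLaurent : laurentToCell.comp cellToLaurent = RingHom.id Lit.CellRing := by
  refine RingHom.ext fun x => ?_
  have h := congrFun (congrArg DFunLike.coe (QuadTorus.Φ_comp_Ψ ℚ)) (cellRingEquiv x)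
  simp only [RingHom.comp_apply, RingHom.id_apply] at h ⊢
  rw [laurentToCell, cellToLaurent, RingHom.comp_apply, RingHom.comp_apply]
  show cellRingEquiv.symm (QuadTorus.Φ ℚ (QuadTorus.Ψ ℚ (cellRingEquiv x))) = x
  rw [h, RingEquiv.symm_apply_apply]

/-- `cellToLaurent ∘ laurentToCell = id`.
[cite: Hu2025, Thm. 9.4 p.161; [Hu22] p.132 l.43–51; joint J1 = GAP-LEDGER-HU row HU-R01 (unrefereed preprints under adjudication, D-0012/D-0089 — kernel statement about OUR typed records; nothing of the sources asserted)] -/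
theorem cellToLaurent_comp_laurentToCell : cellToLaurent.comp laurentToCell = RingHom.id (QuadTorus.LaurentSlice ℚ) := by
  refine RingHom.ext fun x => ?_
  have h := congrFun (congrArg DFunLike.coe (QuadTorus.Ψ_comp_Φ ℚ)) x
  simp only [RingHom.comp_apply, RingHom.id_apply] at h ⊢
  rw [laurentToCell, cellToLaurent, RingHom.comp_apply, RingHom.comp_apply]
  show QuadTorus.Ψ ℚ (cellRingEquiv (cellRingEquiv.symm (QuadTorus.Φ ℚ x))) = x
  rw [RingEquiv.apply_symm_apply, h]

/-- `laurentToCell ∘ ιL = quotHom` (from `QuadTorus.Φ_ιL`).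
[cite: Hu2025, Thm. 9.4 p.161; [Hu22] p.132 l.43–51; joint J1 = GAP-LEDGER-HU row HU-R01 (unrefereed preprints under adjudication, D-0012/D-0089 — kernel statement about OUR typed records; nothing of the sources asserted)] -/
theorem laurentToCell_comp_ιL : laurentToCell.comp (QuadTorus.ιL ℚ) = quotHom := by
  refine RingHom.ext fun y => ?_
  rw [RingHom.comp_apply, laurentToCell, RingHom.comp_apply, QuadTorus.Φ_ιL, quotHom, RingHom.comp_apply]

/-- **`cellIsoLaurent : Gr_d ≅ X_quad × 𝔾⁸_m`** (the cell of the record vs. `Spec` of the Laurent ring over the slice). OURS.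
[cite: Hu2025, Thm. 9.4 («U is isomorphic to the quotient space Gr̄_d := Gr_d/(𝔾ⁿ_m/𝔾_m)») p.161; [Hu22] p.131 l.6–16, p.132 l.30–51 («(9.4) Gr_d|_O ≅ O × (𝔾ⁿ_m/𝔾_m)»); joint J1 = GAP-LEDGER-HU row HU-R01 (unrefereed preprints under adjudication, D-0012/D-0089 — kernel statement about OUR typed records of rows 101/110; nothing of the sources asserted)] -/
def cellIsoLaurent : Lit.cellScheme ≅ laurentX where
  hom := Spec.map (CommRingCat.ofHom laurentToCell)
  inv := Spec.map (CommRingCat.ofHom cellToLaurent)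
  hom_inv_id := by
    show Spec.map (CommRingCat.ofHom laurentToCell) ≫ Spec.map (CommRingCat.ofHom cellToLaurent) =
      𝟙 (Spec (CommRingCat.of Lit.CellRing))
    rw [← Spec.map_comp, ← CommRingCat.ofHom_comp, laurentToCell_comp_cellToLaurent, CommRingCat.ofHom_id, Spec.map_id]
  inv_hom_id := by
    show Spec.map (CommRingCat.ofHom cellToLaurent) ≫ Spec.map (CommRingCat.ofHom laurentToCell) =
      𝟙 (Spec (CommRingCat.of (QuadTorus.LaurentSlice ℚ)))
    rw [← Spec.map_comp, ← CommRingCat.ofHom_comp, cellToLaurent_comp_laurentToCell, CommRingCat.ofHom_id, Spec.map_id]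

/-- **`cellIsoLaurent.hom ≫ laurentProj = quotX`**: up to the isomorphism `Gr_d ≅ X_quad × 𝔾⁸_m`, the quotient map `π = quotX` of
the (β)-inhabitant IS the projection to `X_quad` — (9.4) of [Hu22] p.132 with one open set, for `d = quad` (OURS, `Spec`-of-Laurent
form; the transcription to row 110 g's `splitTorusOver` is not done here).
[cite: Hu2025, Thm. 9.4 p.161; [Hu22] p.131 l.10–16 («the quotient map π»), p.132 l.30–51 («(9.4) Gr_d|_O ≅ O × (𝔾ⁿ_m/𝔾_m)»); joint J1 = GAP-LEDGER-HU row HU-R01 (unrefereed preprints under adjudication, D-0012/D-0089 — kernel statement about OUR typed records of rows 101/110; nothing of the sources asserted)] -/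
theorem cellIsoLaurent_hom_laurentProj : cellIsoLaurent.hom ≫ laurentProj = quotX := by
  show Spec.map (CommRingCat.ofHom laurentToCell) ≫ Spec.map (CommRingCat.ofHom (QuadTorus.ιL ℚ)) =
    Spec.map (CommRingCat.ofHom quotHom)
  rw [← Spec.map_comp, ← CommRingCat.ofHom_comp, laurentToCell_comp_ιL]

end Torus

end Literature.AlgebraicGeometry.Hu2025.Statements.S01S09Interface

end
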